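import Mathlib
import HarnessLib
import Literature.Analysis.FluidPDE.ClassicalSolution
import Literature.Analysis.FluidPDE.LerayHopf
import Literature.Analysis.FluidPDE.NSVorticityBKMEnergy
import Literature.Analysis.FluidPDE.BKMClassTimeDerivativeL2
import Summits.NavierStokesRegularity.NavierStokesRegularity.Theorems.QuarterJoltEdgeLawSlice

/-!
# Route QuarterJolt — crux `NoTerminalJolt` (stmt-NavierStokesRegularity-26463): the EDGE LAW, II.
# Class packaging, the weight, the `div`–`curl` conversion, and the terminal passage

Seat ns-qj-p1 g2 (`--supports 26463 --as helper`); second of four files (see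
`QuarterJoltEdgeLawSlice` for the statement of the edge law and its position w.r.t. the crux).

THIS FILE (tools, all [folklore]):
* `slice_le_of_classical` — the slice inequality of `EdgeLaw.slice_le` at an interior time `τ` of a
  closed slab `[0, S]` for an unforced classical solution in Tao's class
  (`HasBoundedSobolevNormsOn`): the hypotheses of `slice_le` are supplied by the class —
  `∂ₜu(τ) ∈ L²` (Majda–Bertozzi Thm. 3.5, `exists_lintegral_enorm_timeDerivWithin_sq_le`) and the
  pressure is the normalised one up to a constant (Tao 2013 Lemma 4.1 (i),
  `pressure_sub_pressurePotential_eq`), which is in `L²` (`integral_normalisedPressure_sq_le_of_bound`);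
* `hasDerivAt_neg_four_sqrt_sqrt`, `integral_weight_eq` — the weight `h(τ) = 1/(√(T−τ)√√(T−τ))
  = (T−τ)^{-3/4}` and `∫_t^σ h = 4((T−t)^{1/4} − (T−σ)^{1/4})`;
* `integral_frobeniusNormSq_le_of_curl` — the slice law read on the full gradient
  (`∫|Dv|²_F ≤ ∫|curl v|²`, tree theorem `lintegral_frobeniusNormSq_fderiv_le_lintegral_sq_norm_curl`);
* `integral_norm_sub_sq_terminal_le` — from `∫‖u(s) − u(t)‖² ≤ L` for all `s ∈ (t, T)` to
  `∫‖u(T) − u(t)‖² ≤ L`: the Leray–Hopf value `u(T)` is the weak `L²` limit of `u(s)` (field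
  `weak_continuous`), and `‖w‖² = lim ∫⟪u(s) − u(t), w⟫ ≤ (L + ‖w‖²)/2` for `w = u(T) − u(t)`.

HONEST FRAMING: a conditional statement about a HYPOTHETICAL quarter-law blow-up (it calibrates the
crux; it does not move it). Nothing here proves `EnstrophyQuarterLaw` (stmt-1574), `NoTerminalJolt`
(stmt-26463) or Navier–Stokes regularity; all three stay OPEN. No summit statement is proved here.
[folklore]
-/

noncomputable section

-- the summit and its single sub-problem share the name (CONVENTIONS §1), as in every Theorems file
set_option linter.dupNamespace false

namespace Summit.NavierStokesRegularity.NavierStokesRegularity.Theorems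

open MeasureTheory Set Function Filter Topology InnerProductSpace
open scoped ENNReal NNReal ContDiff RealInnerProductSpace Laplacian
open Literature.Analysis.FluidPDE

namespace EdgeLaw

/-- **The slice inequality at an interior time of a closed slab, in Tao's class.** For `ν > 0`,
`S > 0`, an unforced classical solution `(u, p)` on `[0, S] × ℝ³` with all spatial `L²`-Sobolev
norms of `u` bounded on `[0, S]` (`HasBoundedSobolevNormsOn`), an interior time `τ ∈ (0, S)`, a
bound `‖u(τ)‖ ≤ M`, a frozen `C¹` divergence-free field `U` with `U, DU ∈ L²`, and `λ > 0`:
`2∫⟪u(τ) − U, ∂ₜu(τ)⟫ ≤ (ν/2)∫|DU|²_F + λ∫‖u(τ) − U‖² + (M²/λ)∫|Du(τ)|²_F`.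
The hypotheses of `slice_le` are supplied by the class: `∂ₜu(τ) ∈ L²` (Majda–Bertozzi Thm. 3.5,
`IsClassicalNSSolutionOn.exists_lintegral_enorm_timeDerivWithin_sq_le`), and the pressure is the
normalised one up to a constant at interior times (Tao 2013 Lemma 4.1 (i),
`pressure_sub_pressurePotential_eq`), which is in `L²` (`integral_normalisedPressure_sq_le_of_bound`).
[folklore] -/
theorem slice_le_of_classical {ν S : ℝ} (hν : 0 < ν) (hS : 0 < S)
    {u : ℝ → EuclideanSpace ℝ (Fin 3) → EuclideanSpace ℝ (Fin 3)} {p : ℝ → EuclideanSpace ℝ (Fin 3) → ℝ}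
    (hsol : IsClassicalNSSolutionOn (Icc 0 S) ν 0 u p) (hB : HasBoundedSobolevNormsOn (Icc 0 S) u)
    {τ : ℝ} (hτ : τ ∈ Ioo 0 S) {U : EuclideanSpace ℝ (Fin 3) → EuclideanSpace ℝ (Fin 3)}
    (hU : ContDiff ℝ 1 U)
    (hdivU : VectorCalculus.IsDivFree U)
    (l2U : ∫⁻ x, ‖U x‖ₑ ^ 2 < ⊤) (l2DU : ∫⁻ x, ‖fderiv ℝ U x‖ₑ ^ 2 < ⊤)
    {M : ℝ} (hM : ∀ x, ‖u τ x‖ ≤ M) {lam : ℝ} (hlam : 0 < lam) :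
    2 * ∫ x, ⟪u τ x - U x, timeDerivWithin (Icc 0 S) u τ x⟫ ≤
      ν / 2 * (∫ x, frobeniusNormSq (fderiv ℝ U x)) + lam * (∫ x, ‖u τ x - U x‖ ^ 2) +
        M ^ 2 / lam * ∫ x, frobeniusNormSq (fderiv ℝ (u τ) x) := by
  have hτ' : τ ∈ Icc 0 S := Ioo_subset_Icc_self hτ
  have hu : ∀ t ∈ Icc 0 S, ContDiff ℝ ∞ (u t) := fun t ht => hsol.contDiff_velocity ht
  -- class data: energy and a uniform bound
  obtain ⟨⟨I₀, hI₀⟩, -⟩ := levelSq_bounds_of_hasBoundedSobolevNormsOn hu hB 0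
  obtain ⟨B₀, -, hB₀⟩ := exists_forall_norm_iteratedFDeriv_le_bkmClass hu hB 0
  have huB : ∀ t ∈ Icc 0 S, ∀ x, ‖u t x‖ ≤ B₀ := fun t ht x => by
    have := hB₀ t ht x; rwa [norm_iteratedFDeriv_zero] at this
  have hE_int : ∀ t ∈ Icc 0 S, Integrable fun x => ‖u t x‖ ^ 2 := fun t ht =>
    (hI₀ t ht).1.congr (Eventually.of_forall fun x => levelSq_zero_eq_norm_sq (u t) x)
  have hE_le : ∀ t ∈ Icc 0 S, ∫ x, ‖u t x‖ ^ 2 ≤ I₀ := fun t ht => by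
    rw [← integral_congr_ae (Eventually.of_forall fun x => levelSq_zero_eq_norm_sq (u t) x)]
    exact (hI₀ t ht).2
  have hI₀0 : 0 ≤ I₀ := (integral_nonneg fun x => sq_nonneg _).trans (hE_le τ hτ')
  -- the pressure at the interior time `τ` is the normalised one up to a constant
  obtain ⟨c₀, hc₀⟩ : ∃ c₀ : ℝ, c₀ = p τ 0 - pressurePotential (u τ) 0 := ⟨_, rfl⟩
  have hQ : ∀ x, p τ x = normalisedPressure (u τ) x + c₀ := by
    intro x
    have h1 := pressure_sub_pressurePotential_eq hν.le hsol hI₀0 hE_int hE_le hτ x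
    rw [normalisedPressure_eq_pressurePotential ((hu τ hτ').of_le (by norm_cast)) (hE_int τ hτ') x,
      hc₀]
    linarith
  obtain ⟨hQ2, -⟩ := integral_normalisedPressure_sq_le_of_bound (hu τ hτ') (hE_int τ hτ')
    (hE_le τ hτ') (huB τ hτ')
  -- the shifted pressure `π = p(τ) − c₀ = Q[u(τ)]`
  obtain ⟨π, hπdef⟩ : ∃ π : EuclideanSpace ℝ (Fin 3) → ℝ, π = fun x => p τ x - c₀ := ⟨_, rfl⟩
  have hπQ : ∀ x, π x = normalisedPressure (u τ) x := fun x => by rw [hπdef]; simp only [hQ x]; ring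
  have hπ : ContDiff ℝ 1 π := by
    rw [hπdef]; exact ((hsol.contDiff_pressure hτ').sub contDiff_const).of_le (by norm_cast)
  have hgradπ : ∀ x, gradient π x = gradient (p τ) x := fun x => by
    rw [hπdef, gradient, gradient, fderiv_sub_const]
  have l2π : ∫⁻ x, ‖π x‖ₑ ^ 2 < ⊤ := by
    have h1 : ∀ x, ‖π x‖ₑ ^ 2 = ‖normalisedPressure (u τ) x ^ 2‖ₑ := fun x => by
      rw [hπQ x, enorm_pow]
    simp_rw [h1]
    exact hQ2.2
  -- the momentum equation at `τ` (no force), with the shifted pressure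
  have hmom : ∀ x, timeDerivWithin (Icc 0 S) u τ x + convect (u τ) (u τ) x =
      ν • (Δ (u τ)) x - gradient π x := fun x => by
    rw [hgradπ x]; simpa using hsol.momentum τ hτ' x
  -- `∂ₜu(τ)` is continuous and in `L²`
  have hW : Continuous (timeDerivWithin (Icc 0 S) u τ) :=
    ((hsol.smooth_velocity.timeDerivWithin (uniqueDiffOn_Icc hS)).contDiff_slice hτ').continuous
  obtain ⟨Λ, hΛtop, hΛ⟩ := hsol.exists_lintegral_enorm_timeDerivWithin_sq_le hν.le hS hB
  have l2W : ∫⁻ x, ‖timeDerivWithin (Icc 0 S) u τ x‖ₑ ^ 2 < ⊤ :=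
    (hΛ τ hτ').trans_lt hΛtop.lt_top
  -- Sobolev norms of the slice `u(τ)`
  obtain ⟨C₀, hC₀⟩ := hB 0
  obtain ⟨C₁, hC₁⟩ := hB 1
  obtain ⟨C₂, hC₂⟩ := hB 2
  have l2v : ∫⁻ x, ‖u τ x‖ₑ ^ 2 < ⊤ := by
    refine lt_of_le_of_lt (le_of_eq (lintegral_congr fun x => ?_))
      ((hC₀ τ hτ').trans_lt ENNReal.coe_lt_top)
    rw [← ofReal_norm, ← ofReal_norm, norm_iteratedFDeriv_zero]
  have l2Dv : ∫⁻ x, ‖fderiv ℝ (u τ) x‖ₑ ^ 2 < ⊤ :=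
    lintegral_enorm_sq_lt_top_of_norm_le (fun x => by
      rw [← norm_iteratedFDeriv_fderiv, norm_iteratedFDeriv_zero])
      ((hC₁ τ hτ').trans_lt ENNReal.coe_lt_top)
  have l2D2v : ∫⁻ x, ‖iteratedFDeriv ℝ 2 (u τ) x‖ₑ ^ 2 < ⊤ :=
    (hC₂ τ hτ').trans_lt ENNReal.coe_lt_top
  exact slice_le hν.le ((hu τ hτ').of_le (by norm_cast)) hU hW hπ hmom (hsol.divFree τ hτ') hdivU
    hM l2v l2Dv l2D2v l2U l2DU l2W l2π hlam

/-! ### Calculus of the weight `h(τ) = (T−τ)^{-3/4} = 1/(√(T−τ)·√√(T−τ))` -/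

/-- `d/dτ (−4 √√(T−τ)) = 1/(√(T−τ) √√(T−τ))` for `τ < T`. [folklore] -/
theorem hasDerivAt_neg_four_sqrt_sqrt {T τ : ℝ} (hτ : τ < T) :
    HasDerivAt (fun σ => -4 * Real.sqrt (Real.sqrt (T - σ)))
      (1 / (Real.sqrt (T - τ) * Real.sqrt (Real.sqrt (T - τ)))) τ := by
  have hTτ : 0 < T - τ := sub_pos.2 hτ
  have hA : 0 < Real.sqrt (T - τ) := Real.sqrt_pos.2 hTτ
  have hr : 0 < Real.sqrt (Real.sqrt (T - τ)) := Real.sqrt_pos.2 hA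
  have h1 : HasDerivAt (fun σ => T - σ) (-1) τ := by
    simpa using (hasDerivAt_id τ).const_sub T
  have h2 : HasDerivAt (fun σ => Real.sqrt (T - σ)) ((-1) / (2 * Real.sqrt (T - τ))) τ :=
    h1.sqrt hTτ.ne'
  have h3 : HasDerivAt (fun σ => Real.sqrt (Real.sqrt (T - σ)))
      (((-1) / (2 * Real.sqrt (T - τ))) / (2 * Real.sqrt (Real.sqrt (T - τ)))) τ :=
    h2.sqrt hA.ne'
  have h4 := h3.const_mul (-4)
  have e : (-4) * (((-1) / (2 * Real.sqrt (T - τ))) / (2 * Real.sqrt (Real.sqrt (T - τ)))) =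
      1 / (Real.sqrt (T - τ) * Real.sqrt (Real.sqrt (T - τ))) := by
    field_simp
    ring
  rw [e] at h4
  exact h4

/-- `∫_t^σ dτ/(√(T−τ)√√(T−τ)) = 4(√√(T−t) − √√(T−σ))` for `t ≤ σ < T`. [folklore] -/
theorem integral_weight_eq {T t σ : ℝ} (htσ : t ≤ σ) (hσ : σ < T) :
    ∫ τ in t..σ, 1 / (Real.sqrt (T - τ) * Real.sqrt (Real.sqrt (T - τ))) =
      4 * Real.sqrt (Real.sqrt (T - t)) - 4 * Real.sqrt (Real.sqrt (T - σ)) := by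
  have hcontH : ContinuousOn (fun τ => -4 * Real.sqrt (Real.sqrt (T - τ))) (Icc t σ) :=
    (continuous_const.mul ((continuous_const.sub continuous_id).sqrt.sqrt)).continuousOn
  have hconth : ContinuousOn (fun τ => 1 / (Real.sqrt (T - τ) * Real.sqrt (Real.sqrt (T - τ))))
      (Icc t σ) := by
    refine continuousOn_const.div
      (((continuous_const.sub continuous_id).sqrt.mul
        (continuous_const.sub continuous_id).sqrt.sqrt).continuousOn) fun τ hτ => ?_
    have hTτ : 0 < T - τ := by linarith [hτ.2]
    exact (mul_pos (Real.sqrt_pos.2 hTτ) (Real.sqrt_pos.2 (Real.sqrt_pos.2 hTτ))).ne'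
  have h := intervalIntegral.integral_eq_sub_of_hasDerivAt_of_le htσ hcontH
    (fun τ hτ => hasDerivAt_neg_four_sqrt_sqrt (hτ.2.trans hσ))
    (hconth.intervalIntegrable_of_Icc htσ)
  rw [h]
  ring

/-! ### The `div`–`curl` conversion of the slice law -/

/-- For a divergence-free `v ∈ C²` with `v, Dv ∈ L²` and `∫|curl v|² ≤ B` (`B ≥ 0`): `|Dv|²_F` is
integrable and `∫ |Dv|²_F ≤ B` (the tree's `L²` `div`–`curl` estimate
`lintegral_frobeniusNormSq_fderiv_le_lintegral_sq_norm_curl`). [folklore] -/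
theorem integral_frobeniusNormSq_le_of_curl {v : EuclideanSpace ℝ (Fin 3) → EuclideanSpace ℝ (Fin 3)}
    (hv : ContDiff ℝ 2 v)
    (hdiv : VectorCalculus.IsDivFree v) (l2v : ∫⁻ x, ‖v x‖ₑ ^ 2 < ⊤)
    (l2Dv : ∫⁻ x, ‖fderiv ℝ v x‖ₑ ^ 2 < ⊤) {B : ℝ} (hB : 0 ≤ B)
    (hcurl : ∫⁻ x, ‖curl v x‖ₑ ^ 2 ≤ ENNReal.ofReal B) :
    Integrable (fun x => frobeniusNormSq (fderiv ℝ v x)) volume ∧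
      ∫ x, frobeniusNormSq (fderiv ℝ v x) ≤ B := by
  have hlt : ∫⁻ x, ENNReal.ofReal (frobeniusNormSq (fderiv ℝ v x)) < ⊤ :=
    calc ∫⁻ x, ENNReal.ofReal (frobeniusNormSq (fderiv ℝ v x))
        ≤ ∫⁻ x, 3 * ‖fderiv ℝ v x‖ₑ ^ 2 :=
          lintegral_mono fun x => ofReal_frobeniusNormSq_le_three_mul_enorm_sq _
      _ = 3 * ∫⁻ x, ‖fderiv ℝ v x‖ₑ ^ 2 := lintegral_const_mul' _ _ (by norm_num)
      _ < ⊤ := ENNReal.mul_lt_top (by norm_num) l2Dv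
  have hint : Integrable (fun x => frobeniusNormSq (fderiv ℝ v x)) volume :=
    integrable_of_continuous_of_nonneg (continuous_frobeniusNormSq_fderiv hv (by simp))
      (fun x => frobeniusNormSq_nonneg _) hlt
  refine ⟨hint, ?_⟩
  have h1 := lintegral_frobeniusNormSq_fderiv_le_lintegral_sq_norm_curl hv hdiv l2v
  rw [← ofReal_integral_eq_lintegral_ofReal hint
    (Eventually.of_forall fun x => frobeniusNormSq_nonneg _)] at h1
  exact (ENNReal.ofReal_le_ofReal_iff hB).1 (h1.trans hcurl)

/-! ### Passage to the terminal time: weak lower semicontinuity -/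

/-- `⟪f, g⟫` is integrable for two `L²` fields. [folklore] -/
theorem integrable_inner_of_memLp {f g : EuclideanSpace ℝ (Fin 3) → EuclideanSpace ℝ (Fin 3)}
    (hf : MemLp f 2 volume) (hg : MemLp g 2 volume) :
    Integrable (fun x => ⟪f x, g x⟫) volume := by
  refine (hf.norm.integrable_mul hg.norm).mono' (hf.1.inner hg.1) (Eventually.of_forall fun x => ?_)
  rw [Real.norm_eq_abs]
  simpa using abs_real_inner_le_norm (f x) (g x)

/-- **From the sub-slabs to the terminal slice.** If `u` is Leray–Hopf on `[0, T]`, `t ∈ [0, T)`,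
and `∫‖u(s) − u(t)‖² ≤ L` for all `s ∈ (t, T)`, then `∫‖u(t) − u(T)‖² ≤ L`: the Leray–Hopf value
`u(T)` is the weak `L²` limit of `u(s)`, `s ↑ T` (field `weak_continuous`), and the squared `L²` norm
is weakly lower semicontinuous (tested against `w = u(T) − u(t)`:
`‖w‖² = lim ∫⟪u(s) − u(t), w⟫ ≤ (L + ‖w‖²)/2`). [folklore] -/
theorem integral_norm_sub_sq_terminal_le {ν T L : ℝ} (hT : 0 < T)
    {u : ℝ → EuclideanSpace ℝ (Fin 3) → EuclideanSpace ℝ (Fin 3)}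
    (hLH : IsLerayHopfOn T ν 0 (u 0) u) {t : ℝ} (ht : t ∈ Ico 0 T)
    (h : ∀ s ∈ Ioo t T, ∫ x, ‖u s x - u t x‖ ^ 2 ≤ L) :
    ∫ x, ‖u t x - u T x‖ ^ 2 ≤ L := by
  have hmt : MemLp (u t) 2 volume := hLH.memLp t ⟨ht.1, ht.2.le⟩
  have hmT : MemLp (u T) 2 volume := hLH.memLp T ⟨hT.le, le_rfl⟩
  obtain ⟨w, hwdef⟩ : ∃ w : EuclideanSpace ℝ (Fin 3) → EuclideanSpace ℝ (Fin 3),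
      w = fun x => u T x - u t x := ⟨_, rfl⟩
  have hwx : ∀ x, w x = u T x - u t x := fun x => by rw [hwdef]
  have hw : MemLp w 2 volume := by rw [hwdef]; exact hmT.sub hmt
  obtain ⟨a, hadef⟩ : ∃ a : ℝ, a = ∫ x, ‖w x‖ ^ 2 := ⟨_, rfl⟩
  have iww : Integrable (fun x => ‖w x‖ ^ 2) volume := hw.integrable_norm_pow two_ne_zero
  -- the pairing limit `∫⟪u s, w⟫ → ∫⟪u T, w⟫` as `s ↑ T`
  have hle_filter : 𝓝[<] T ≤ 𝓝[Ioc 0 T] T := by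
    rw [← nhdsWithin_Ioo_eq_nhdsLT hT]
    exact nhdsWithin_mono _ Ioo_subset_Ioc_self
  have hlim : Tendsto (fun s => ∫ x, ⟪u s x, w x⟫) (𝓝[<] T) (𝓝 (∫ x, ⟪u T x, w x⟫)) :=
    (((hLH.weak_continuous w hw).1) T ⟨hT, le_rfl⟩).tendsto.mono_left hle_filter
  -- the eventual bound `∫⟪u s, w⟫ ≤ ∫⟪u t, w⟫ + (L + a)/2`
  have hev : ∀ᶠ s in 𝓝[<] T, ∫ x, ⟪u s x, w x⟫ ≤ (∫ x, ⟪u t x, w x⟫) + (L + a) / 2 := by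
    filter_upwards [Ioo_mem_nhdsLT ht.2] with s hs
    have hms : MemLp (u s) 2 volume := hLH.memLp s ⟨ht.1.trans hs.1.le, hs.2.le⟩
    have hd : MemLp (fun x => u s x - u t x) 2 volume := hms.sub hmt
    have e1 : (∫ x, ⟪u s x, w x⟫) - ∫ x, ⟪u t x, w x⟫ = ∫ x, ⟪u s x - u t x, w x⟫ := by
      rw [← integral_sub (integrable_inner_of_memLp hms hw) (integrable_inner_of_memLp hmt hw)]
      exact integral_congr_ae (Eventually.of_forall fun x => by simp only [inner_sub_left])
    have e2 : ∫ x, ⟪u s x - u t x, w x⟫ ≤ ∫ x, (‖u s x - u t x‖ ^ 2 + ‖w x‖ ^ 2) / 2 := by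
      refine integral_mono (integrable_inner_of_memLp hd hw)
        (((hd.integrable_norm_pow two_ne_zero).add iww).div_const 2) fun x => ?_
      have h1 : ⟪u s x - u t x, w x⟫ ≤ ‖u s x - u t x‖ * ‖w x‖ := real_inner_le_norm _ _
      simp only
      nlinarith [sq_nonneg (‖u s x - u t x‖ - ‖w x‖)]
    have e3 : ∫ x, (‖u s x - u t x‖ ^ 2 + ‖w x‖ ^ 2) / 2 = ((∫ x, ‖u s x - u t x‖ ^ 2) + a) / 2 := by
      rw [integral_div, integral_add (hd.integrable_norm_pow two_ne_zero) iww, hadef]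
    linarith [h s hs]
  have hTle : ∫ x, ⟪u T x, w x⟫ ≤ (∫ x, ⟪u t x, w x⟫) + (L + a) / 2 := le_of_tendsto hlim hev
  -- `a = ∫⟪u T, w⟫ − ∫⟪u t, w⟫`
  have ha : a = (∫ x, ⟪u T x, w x⟫) - ∫ x, ⟪u t x, w x⟫ := by
    rw [← integral_sub (integrable_inner_of_memLp hmT hw) (integrable_inner_of_memLp hmt hw), hadef]
    refine integral_congr_ae (Eventually.of_forall fun x => ?_)
    simp only
    rw [← inner_sub_left, ← hwx, real_inner_self_eq_norm_sq]
  have hgoal : ∫ x, ‖u t x - u T x‖ ^ 2 = a := by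
    rw [hadef]
    exact integral_congr_ae (Eventually.of_forall fun x => by simp only [hwx, norm_sub_rev])
  rw [hgoal]
  linarith

end EdgeLaw

end Summit.NavierStokesRegularity.NavierStokesRegularity.Theorems

end
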